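import Literature.NumberTheory.Automorphic.AlgebraicWeightFinitenessOfGLIntegers
import Literature.NumberTheory.Automorphic.CongruenceSubgroupCohomologyFiniteDimensional
import Literature.NumberTheory.Automorphic.ArithmeticGroupCohomologyFiniteness
import HarnessLib

/-!
# The four Borel–Serre-dependent named facts from the one printed theorem "torsion-free
# arithmetic subgroups of `GL_n(𝓞_K)` are of type (FL)" (over `ℤ`)

Topic `NumberTheory/Automorphic`; namespace `Literature.NumberTheory.Automorphic`.  Theorems only;
no named fact, no instance, no `sorry`.

Four named facts of the tree rest on the finiteness theorem of Borel–Serre for arithmetic groups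
and are reduced, in their own files, to an explicit hypothesis:

* `algebraicWeightEigenclass_continuousPoint` ([Scholze2015, Thm. V.4.1 / Cor. V.4.2];
  `AlgebraicWeight.algebraicWeightEigenclass_continuousPoint_of_typeFL_torsionFree`),
* `BorelSerre1973_finite_groupCohomology_congruenceSubgroup` (finite coefficients;
  `…_of_typeFL_torsionFree` of `ArithmeticQuotientCohomologyFiniteProofs`),
* `BorelSerre1973_finiteDimensional_groupCohomology_congruenceSubgroup` (field coefficients;
  `CongruenceSubgroupCohomologyFiniteDimensional`, there from resolutions over every FIELD),
* `BorelSerre1973_finiteDimensional_groupCohomology` (`GL_n(ℤ)`, field coefficients;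
  `ArithmeticGroupCohomologyFinitenessProofs`, there from resolutions over every field of the
  torsion-free subgroups of finite index of `GL_n(ℤ)`).

This file shows that ONE hypothesis, the theorem AS PRINTED and over `ℤ` —

  `hTF`: for every `n`, every number field `K` and every torsion-free subgroup `Γ'` of finite index
  of `GL_n(𝓞_K)` (Mathlib `GL (Fin n) (𝓞 K)`), the trivial `ℤ[Γ']`-module `ℤ` admits a projective
  resolution by free `ℤ[Γ']`-modules of finite rank ([BorelSerre1973, §11.1 (c)]: "The group `Γ`
  is of type (FL) … a triangulation of `X̄/Γ` lifts to a `Γ`-invariant triangulation of `X̄` and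
  the corresponding complex of simplicial chains `0 → C_d → ⋯ → C_0 → ℤ → 0` gives a
  `ℤ[Γ]`-free resolution of finite type of the `ℤ[Γ]`-module `ℤ`", for the arithmetic subgroups
  of `R_{K/ℚ} GL_n` by 11.6) —

discharges all four (`borelSerre_consequences_of_typeFL_torsionFree`).  The passage from `ℤ` to
field / `ℤ_p` coefficients is `isCohFiniteTypeUpTo_one_of_int_resolution` (restriction of
scalars, `GroupCohomologyIntResolutionFiniteType`); the passage from `GL_n(𝓞_ℚ)` to `GL_n(ℤ)` is
Mathlib's `Rat.ringOfIntegersEquiv`.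

## References

* A. Borel, J.-P. Serre, *Corners and arithmetic groups*, Comment. Math. Helv. 48 (1973),
  §11.1 (c), Thm. 11.4.4, 11.6. [BorelSerre1973]
* J.-P. Serre, *Cohomologie des groupes discrets* (1971), §1.8, §2.4 Th. 4 (a).
  [Serre1971CohomologieGroupesDiscrets]
* P. Scholze, Ann. of Math. 182 (2015), §V.4. [Scholze2015]
* K. S. Brown, *Cohomology of Groups*, GTM 87 (1982), VIII (5.1), VIII.4 Ex. 1.
  [Brown1982CohomologyGroups]
-/

noncomputable section

open CategoryTheory
open IsDedekindDomain NumberField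
open Literature.Algebra.Homology
open Literature.NumberTheory.Automorphic.BigHeckeGLn

namespace Literature.NumberTheory.Automorphic

/-! ### Field coefficients, congruence subgroups of `GL_n(K)` -/

/-- **`BorelSerre1973_finiteDimensional_groupCohomology_congruenceSubgroup` from "`GL_n(𝓞_K)` is
virtually of type (FL)" OVER `ℤ`** (the file `CongruenceSubgroupCohomologyFiniteDimensional` takes
resolutions over every field; a resolution over `ℤ` suffices, by restriction of scalars).
[cite: BorelSerre1973, §11.1 (c), Thm. 11.4.4, 11.6] [cite: Brown1982CohomologyGroups, VIII (5.1), VIII.4 Ex. 1] -/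
theorem BorelSerre1973_finiteDimensional_groupCohomology_congruenceSubgroup_of_glIntegers_int
    (h : ∀ (n : ℕ) (K : Type) [Field K] [NumberField K],
      ∃ Γ' : Subgroup (GL (Fin n) (𝓞 K)), Γ'.FiniteIndex ∧
        ∃ P : ProjectiveResolution (Rep.trivial ℤ Γ' ℤ),
          ∀ i, ∃ m : ℕ, Nonempty (P.complex.X i ≅ Rep.free ℤ Γ' (Fin m))) :
    BorelSerre1973_finiteDimensional_groupCohomology_congruenceSubgroup := by
  intro k _ n K _ _ U hUo hUc A hA q
  obtain ⟨Γ', hΓ', P, hP⟩ := h n K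
  haveI := hΓ'
  obtain ⟨m, -, hft⟩ := AlgebraicWeight.exists_isCohFiniteTypeUpTo_of_glIntegers K n k Γ' P hP
    (U.comap (globalEmbedding n K)) (commensurable_comap_globalEmbedding_glIntegers U hUo hUc)
  haveI := hA
  exact hft.moduleFinite A q

/-! ### Field coefficients, subgroups of finite index of `GL_n(ℤ)` -/

/-- **`BorelSerre1973_finiteDimensional_groupCohomology` (`GL_n(ℤ)`) from "`GL_n(𝓞_K)` is
virtually of type (FL)" over `ℤ`**, through `GL_n(𝓞_ℚ) ≃ GL_n(ℤ)` (Mathlib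
`Rat.ringOfIntegersEquiv`): ascent from `Γ'` to `GL_n(𝓞_ℚ)`, transport, descent to the given
subgroup of finite index. [cite: BorelSerre1973, §11.1 (c), Thm. 11.4.4]
[cite: Brown1982CohomologyGroups, VIII (5.1), VIII.4 Ex. 1] -/
theorem BorelSerre1973_finiteDimensional_groupCohomology_of_glIntegers_int
    (h : ∀ (n : ℕ) (K : Type) [Field K] [NumberField K],
      ∃ Γ' : Subgroup (GL (Fin n) (𝓞 K)), Γ'.FiniteIndex ∧
        ∃ P : ProjectiveResolution (Rep.trivial ℤ Γ' ℤ),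
          ∀ i, ∃ m : ℕ, Nonempty (P.complex.X i ≅ Rep.free ℤ Γ' (Fin m))) :
    BorelSerre1973_finiteDimensional_groupCohomology := by
  intro k _ n Γ hΓ A hA q
  obtain ⟨Γ', hΓ', P, hP⟩ := h n ℚ
  haveI := hΓ'
  have h₁ : IsCohFiniteTypeUpTo k Γ' 1 := isCohFiniteTypeUpTo_one_of_int_resolution P hP
  have h₂ : IsCohFiniteTypeUpTo k (GL (Fin n) (𝓞 ℚ)) (1 * Γ'.index) :=
    IsCohFiniteTypeUpTo.of_subgroup (S := Γ') h₁
  let e : GL (Fin n) (𝓞 ℚ) ≃* GL (Fin n) ℤ :=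
    Units.mapEquiv Rat.ringOfIntegersEquiv.mapMatrix.toMulEquiv
  have h₃ : IsCohFiniteTypeUpTo k (GL (Fin n) ℤ) (1 * Γ'.index) :=
    IsCohFiniteTypeUpTo.of_mulEquiv e h₂
  haveI := hΓ
  have h₄ : IsCohFiniteTypeUpTo k Γ (1 * Γ'.index) := h₃.subgroup Γ
  haveI : Module.Finite k A := hA
  exact h₄.moduleFinite A q

/-! ### The four facts from the printed theorem -/

/-- **The four Borel–Serre-dependent named facts of the tree follow from [BorelSerre1973,
§11.1 (c)] as printed** — every torsion-free subgroup of finite index of `GL_n(𝓞_K)` is of type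
(FL) over `ℤ` (with 11.6 for `R_{K/ℚ} GL_n`; the existence of such subgroups is Minkowski's lemma,
proved in the tree: `NumberFields.GeneralLinearGroup.exists_finiteIndex_forall_isOfFinOrder_eq_one`).
[cite: BorelSerre1973, §11.1 (c), Thm. 11.4.4 (proof), 11.6]
[cite: Scholze2015, Thm. V.4.1 and Cor. V.4.2] -/
theorem borelSerre_consequences_of_typeFL_torsionFree
    (h : ∀ (n : ℕ) (K : Type) [Field K] [NumberField K] (Γ' : Subgroup (GL (Fin n) (𝓞 K))),
      Γ'.FiniteIndex → (∀ g : Γ', IsOfFinOrder g → g = 1) →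
      ∃ P : ProjectiveResolution (Rep.trivial ℤ Γ' ℤ),
        ∀ i, ∃ m : ℕ, Nonempty (P.complex.X i ≅ Rep.free ℤ Γ' (Fin m))) :
    algebraicWeightEigenclass_continuousPoint ∧
      BorelSerre1973_finite_groupCohomology_congruenceSubgroup ∧
      BorelSerre1973_finiteDimensional_groupCohomology_congruenceSubgroup ∧
      BorelSerre1973_finiteDimensional_groupCohomology := by
  have hGL : ∀ (n : ℕ) (K : Type) [Field K] [NumberField K],
      ∃ Γ' : Subgroup (GL (Fin n) (𝓞 K)), Γ'.FiniteIndex ∧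
        ∃ P : ProjectiveResolution (Rep.trivial ℤ Γ' ℤ),
          ∀ i, ∃ m : ℕ, Nonempty (P.complex.X i ≅ Rep.free ℤ Γ' (Fin m)) := fun n K _ _ => by
    obtain ⟨Γ', hΓ', htf⟩ :=
      NumberFields.GeneralLinearGroup.exists_finiteIndex_forall_isOfFinOrder_eq_one K (n := Fin n)
    exact ⟨Γ', hΓ', h n K Γ' hΓ' htf⟩
  exact ⟨AlgebraicWeight.algebraicWeightEigenclass_continuousPoint_of_glIntegers hGL,
    BorelSerre1973_finite_groupCohomology_congruenceSubgroup_of_glIntegers hGL,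
    BorelSerre1973_finiteDimensional_groupCohomology_congruenceSubgroup_of_glIntegers_int hGL,
    BorelSerre1973_finiteDimensional_groupCohomology_of_glIntegers_int hGL⟩

end Literature.NumberTheory.Automorphic
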